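import Summits.Schanuel.Schanuel.Theorems.ZilberEacResonantRational
import Summits.Schanuel.Schanuel.Theorems.ZilberEacEquimodularAccumulation
import Summits.Schanuel.Schanuel.Theorems.ZilberEacEquimodularPhases
import Summits.Schanuel.Schanuel.Theorems.ZilberEacSequenceRelation
import HarnessLib

/-!
# The equimodular class, X: the NON-RESONANT members — every equimodular parabola with a
# `y₀`-linear fibre is dense

HONEST FRAMING.  Cell `pub-schanuel` (Zilber's Exponential-Algebraic Closedness, case ladder;
host summit Schanuel), seat 2, gen 22.  Files VI–VII decided the RESONANT members
(`c ∈ -(i/2π)ℚ`, fibre limit `e^{τ + iπℚ}`) by THEOREM T.  Here the complement inside the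
equimodular class: base `x₁ = c(x₀ - τ)² + κ`, `c = -ix/(2π)`, `x ∈ ℝ ∖ {0}`, fibre
`A(x₀)y₀ + B(x₀) = 0` (`deg A = deg B ≥ 1`, coprime) with limit root `e^{τ + iφ}` (the equimodular
circle `|θ| = |e^τ|`), and `x ∉ ℚ` or `xφ/π ∉ ℚ`.  **`unprojectedDense_nonresonantGraphSurface`**:
DENSE.  Proof: exponential points exist with EVERY large label `k` (`exists_expPoint_near_label`,
zero persistence for `Φ(u, ζ) = Ã(u,ζ)θe^ζ + B̃(u,ζ)` at `u = 0`); along them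
`e^{x₁} = urot(xk² + (xφ/π)k + xφ²/4π²)·w(1/x₀)` EXACTLY (file V); if the exponential points were not
dense, THEOREM H (`exists_polyPoly_relation_of_forall_aeval_eq_zero`) gives ONE `H ≠ 0` with
`H(x₀, y₁) = 0` at all of them, so the phases accumulate at a finite set (file IX) — impossible for a
non-resonant quadratic sequence (file VIII).  With files VI–VII:
**`unprojectedDense_equimodularParabola`** — EVERY member of the equimodular class over a parabola
with a `y₀`-linear fibre is dense (gen 18's residual `fibreCurveSurface_residual_of_not_unprojectedDense`
is EMPTY in `y₀`-degree one over parabolas).  Not decided: fibre curves of `y₀`-degree ≥ 2, bases of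
degree ≥ 3, polynomial curves.  Complete classes of instances of an OPEN question (PLMS 2024 §1
p. 5); EC(3,2) OPEN; NOT Schanuel's conjecture (neither used nor implied; EAC ⇏ SC).
-/

noncomputable section

open Filter Topology Set Complex MvPolynomial
open Literature.NumberTheory.Transcendental Literature.ModelTheory.Zilber
open Literature.ModelTheory.ExponentialFields

set_option linter.dupNamespace false

namespace Summit.Schanuel.Schanuel.Theorems

/-! ## Part A. The non-resonant members are dense -/

/-- The resonant phase as a rotation: `exp(c(iφ + 2πik)²) = urot(xk² + (xφ/π)k + xφ²/(4π²))`,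
`c = -ix/(2π)`. [folklore] -/
theorem exp_phase_eq_urot (x φ : ℝ) (k : ℤ) :
    Complex.exp (-(I * (x : ℂ) / (2 * Real.pi)) * ((φ : ℂ) * I + (k : ℂ) * (2 * Real.pi * I)) ^ 2) =
      urot (x * (k : ℝ) ^ 2 + x * φ / Real.pi * k + x * φ ^ 2 / (4 * Real.pi ^ 2)) := by
  have hπ : (Real.pi : ℂ) ≠ 0 := by exact_mod_cast Real.pi_ne_zero
  have h1 : ((φ : ℂ) * I + (k : ℂ) * (2 * Real.pi * I)) ^ 2 = -((φ : ℂ) + 2 * Real.pi * k) ^ 2 := by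
    have e : (φ : ℂ) * I + (k : ℂ) * (2 * Real.pi * I) = ((φ : ℂ) + 2 * Real.pi * k) * I := by ring
    rw [e, mul_pow, Complex.I_sq]; ring
  rw [h1, urot]
  congr 1
  push_cast
  field_simp
  ring

section Main

variable (A B : Polynomial ℂ) {P : MvPolynomial (Fin 2) ℂ}

/-- **THE NON-RESONANT EQUIMODULAR PARABOLAS ARE DENSE.**  `P(x₀, y₀) = A(x₀) y₀ + B(x₀)` irreducible,
`deg A = deg B ≥ 1`, `A, B` coprime, `lc B = -e^{τ + iφ} lc A`; base `x₁ = -(ix/2π)(x₀ - τ)² + κ` with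
`x ≠ 0` and (`x ∉ ℚ` or `xφ/π ∉ ℚ`).  Then the exponential points are Zariski dense.
[cite: MantovaMasser2023, §1 Further remarks, p. 5 (the question, open in general)] (new) -/
theorem unprojectedDense_nonresonantGraphSurface
    (hP : ∀ x y : ℂ, MvPolynomial.eval ![x, y] P = A.eval x * y + B.eval x) (hirr : Irreducible P)
    (hN : 1 ≤ A.natDegree) (hdeg : B.natDegree = A.natDegree) (hcop : IsCoprime A B)
    {x : ℝ} (hx : x ≠ 0) (φ : ℝ) (hnr : Irrational x ∨ Irrational (x * φ / Real.pi)) (τ κ : ℂ)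
    (hlc : B.leadingCoeff = -Complex.exp (τ + φ * I) * A.leadingCoeff) :
    UnprojectedDense {w : Fin 2 ⊕ Fin 2 → ℂ |
      w (Sum.inl 1) = (Polynomial.C (-(I * (x : ℂ) / (2 * Real.pi))) *
        (Polynomial.X - Polynomial.C τ) ^ 2 + Polynomial.C κ).eval (w (Sum.inl 0)) ∧
      MvPolynomial.eval ![w (Sum.inl 0), w (Sum.inr 0)] P = 0} := by
  classical
  set c : ℂ := -(I * (x : ℂ) / (2 * Real.pi)) with hc
  set p : Polynomial ℂ := Polynomial.C c * (Polynomial.X - Polynomial.C τ) ^ 2 + Polynomial.C κ with hp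
  set τ' : ℂ := τ + φ * I with hτ'
  have hπ : (Real.pi : ℂ) ≠ 0 := by exact_mod_cast Real.pi_ne_zero
  have hc0 : c ≠ 0 := by
    rw [hc, neg_ne_zero, div_ne_zero_iff]
    exact ⟨mul_ne_zero Complex.I_ne_zero (by exact_mod_cast hx), mul_ne_zero two_ne_zero hπ⟩
  obtain ⟨w, R, hw, hw0, hK2, -⟩ := exists_resonant_witness A B hN hdeg hcop hc0 τ τ' κ hlc
  -- exponential points with every large label, beyond the radius `R`
  obtain ⟨K, hK⟩ := exists_expPoint_near_label A B hN hdeg τ' hlc one_pos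
  obtain ⟨K', hK'⟩ : ∃ K' : ℕ, ∀ k : ℕ, K' ≤ k → R + ‖τ'‖ + 1 < 2 * Real.pi * k := by
    obtain ⟨K', hK'⟩ := exists_nat_gt ((R + ‖τ'‖ + 1) / (2 * Real.pi))
    refine ⟨K', fun k hk => ?_⟩
    rw [div_lt_iff₀ Real.two_pi_pos] at hK'
    have : (K' : ℝ) ≤ k := by exact_mod_cast hk
    nlinarith [Real.pi_pos]
  set K₀ : ℕ := max K K' with hK₀
  have hzex : ∀ m : ℕ, ∃ z : ℂ, ‖z - τ' - ((K₀ + m : ℕ) : ℂ) * (2 * Real.pi * I)‖ < 1 ∧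
      A.eval z * Complex.exp z + B.eval z = 0 := fun m =>
    hK (K₀ + m) ((le_max_left K K').trans (Nat.le_add_right _ _))
  choose z hzlab hzeq using hzex
  have hzlow : ∀ m, 2 * Real.pi * ((K₀ + m : ℕ) : ℝ) - ‖τ'‖ - 1 ≤ ‖z m‖ := by
    intro m
    have h1 : ‖((K₀ + m : ℕ) : ℂ) * (2 * Real.pi * I)‖ = 2 * Real.pi * ((K₀ + m : ℕ) : ℝ) := by
      rw [norm_mul, Complex.norm_natCast]
      simp [abs_of_pos Real.pi_pos]
      ring
    have h2 := norm_sub_le_norm_sub_add_norm_sub (((K₀ + m : ℕ) : ℂ) * (2 * Real.pi * I))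
      (z m - τ') 0
    rw [sub_zero, sub_zero, norm_sub_rev] at h2
    have h3 : ‖z m - τ'‖ ≤ ‖z m‖ + ‖τ'‖ := norm_sub_le _ _
    linarith [hzlab m]
  have hzR : ∀ m, R < ‖z m‖ := by
    intro m
    have := hK' (K₀ + m) ((le_max_right K K').trans (Nat.le_add_right _ _))
    linarith [hzlow m]
  have hznorm : Tendsto (fun m => ‖z m‖) atTop atTop := by
    refine tendsto_atTop_mono hzlow ?_
    have h1 : Tendsto (fun m : ℕ => 2 * Real.pi * ((K₀ + m : ℕ) : ℝ)) atTop atTop := by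
      refine Tendsto.const_mul_atTop Real.two_pi_pos ?_
      exact tendsto_natCast_atTop_atTop.comp (tendsto_add_atTop_nat K₀ |>.congr fun m => by ring_nf)
    have h2 := tendsto_atTop_add_const_right atTop (-‖τ'‖ - 1) h1
    exact h2.congr fun m => by ring
  -- the exact identity with the label `K₀ + m`, as a rotation
  set e : ℕ → ℂ := fun m => urot (x * (((K₀ + m : ℕ) : ℝ)) ^ 2 + x * φ / Real.pi * ((K₀ + m : ℕ) : ℝ) +
    x * φ ^ 2 / (4 * Real.pi ^ 2)) with he
  have he1 : ∀ m, ‖e m‖ = 1 := fun m => norm_urot _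
  have hid : ∀ m, Complex.exp (p.eval (z m)) = e m * w (z m)⁻¹ := by
    intro m
    obtain ⟨k', hk'lab, hk'⟩ := hK2 (z m) (hzR m) (hzeq m)
    have hkk : k' = ((K₀ + m : ℕ) : ℤ) := by
      refine int_eq_of_norm_sub_lt hk'lab ?_
      have := hzlab m
      exact_mod_cast this
    rw [hp, hk', hkk, he, hτ', add_sub_cancel_left, hc]
    congr 1
    have := exp_phase_eq_urot x φ ((K₀ + m : ℕ) : ℤ)
    push_cast at this ⊢
    exact this
  -- suppose the exponential points are not dense
  by_contra hnot
  rw [fibreCurveSurface_eq] at hnot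
  have hirr3 := irreducible_rename_castSucc₂ hirr
  have hS := isIrreducibleClosed_graphSurface p hirr3
  have hdim := zariskiDim_graphSurface p hirr3
  set S := {w : Fin 2 ⊕ Fin 2 → ℂ | w (Sum.inl 1) = p.eval (w (Sum.inl 0)) ∧
      MvPolynomial.eval ![w (Sum.inl 0), w (Sum.inr 0), w (Sum.inr 1)]
        (rename (Fin.castSucc : Fin 2 → Fin 3) P) = 0} with hSdef
  have hex : ∃ f, f ∈ vanishingIdeal ℂ (S ∩ expGraph ℂ 2) ∧ f ∉ vanishingIdeal ℂ S := by
    by_contra h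
    push Not at h
    exact hnot (le_antisymm h (vanishingIdeal_anti_mono Set.inter_subset_left))
  obtain ⟨f, hfΓ, hfS⟩ := hex
  -- the sequence of exponential points
  set q : ℕ → Fin 2 ⊕ Fin 2 → ℂ := fun m =>
    Sum.elim ![z m, p.eval (z m)] ![Complex.exp (z m), Complex.exp (p.eval (z m))] with hq
  have hqS : ∀ m, q m ∈ S := by
    intro m
    refine ⟨by simp [hq], ?_⟩
    have ev : (![q m (Sum.inl 0), q m (Sum.inr 0), q m (Sum.inr 1)] : Fin 3 → ℂ) =
        ![z m, Complex.exp (z m), Complex.exp (p.eval (z m))] := by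
      simp [hq]
    rw [ev, eval_vec3_rename_castSucc, hP]
    exact hzeq m
  have hqΓ : ∀ m, q m ∈ expGraph ℂ 2 := by
    intro m
    rw [mem_expGraph_iff]
    intro i
    rw [Literature.ModelTheory.ExponentialFields.ExponentialRing.complex_exp_eq]
    fin_cases i <;> simp [hq]
  -- THEOREM H: one relation on all points
  obtain ⟨H, hH0, hH⟩ := exists_polyPoly_relation_of_forall_aeval_eq_zero hS (le_of_eq hdim) hqS hfS
    (fun m => (mem_vanishingIdeal_iff.1 hfΓ) _ ⟨hqS m, hqΓ m⟩) (Sum.inl 0) (Sum.inr 1)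
  have hrel : ∀ m, (H.map (Polynomial.evalRingHom (z m))).eval (e m * w (z m)⁻¹) = 0 := by
    intro m
    have h1 := hH m
    simp only [hq, Sum.elim_inl, Sum.elim_inr, Matrix.cons_val_zero, Matrix.cons_val_one] at h1
    rwa [hid m] at h1
  -- the phases accumulate at a finite set …
  have hwlim : Tendsto (fun m => w (z m)⁻¹) atTop (𝓝 (w 0)) :=
    hw.continuousAt.tendsto.comp (tendsto_inv₀_cobounded.comp (tendsto_norm_atTop_iff_cobounded.1 hznorm))
  obtain ⟨F, hF⟩ := phases_near_finset_of_relation hH0 hznorm he1 (hw0 0) hwlim hrel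
  -- … but a non-resonant quadratic phase sequence does not
  obtain ⟨ε, hε, hfar⟩ := urot_quadratic_not_near_finset hnr (x * φ ^ 2 / (4 * Real.pi ^ 2)) F
  obtain ⟨m₀, hm₀⟩ := Filter.eventually_atTop.1 (hF ε hε)
  obtain ⟨k, hk, hkfar⟩ := hfar (K₀ + m₀)
  obtain ⟨ζ, hζF, hζ⟩ := hm₀ (k - K₀) (by omega)
  have hkk : K₀ + (k - K₀) = k := by omega
  rw [he] at hζ
  simp only [hkk] at hζ
  exact absurd hζ (not_lt.2 (hkfar ζ hζF))

/-- **EVERY EQUIMODULAR PARABOLA WITH A `y₀`-LINEAR FIBRE IS DENSE** (resonant: files VI–VII,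
THEOREM T; non-resonant: this file).  `deg A = deg B ≥ 1`, coprime, `lc B = -e^{τ+iφ} lc A`
(`|θ| = |e^τ|`), base `x₁ = -(ix/2π)(x₀ - τ)² + κ`, `x ∈ ℝ ∖ {0}`.
[cite: MantovaMasser2023, §1 Further remarks, p. 5 (the question, open in general)] (new) -/
theorem unprojectedDense_equimodularParabola
    (hP : ∀ x y : ℂ, MvPolynomial.eval ![x, y] P = A.eval x * y + B.eval x) (hirr : Irreducible P)
    (h1 : ∃ v ∈ P.support, ∃ v' ∈ P.support, v 1 ≠ v' 1) (hN : 1 ≤ A.natDegree)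
    (hdeg : B.natDegree = A.natDegree) (hcop : IsCoprime A B) {x : ℝ} (hx : x ≠ 0) (φ : ℝ) (τ κ : ℂ)
    (hlc : B.leadingCoeff = -Complex.exp (τ + φ * I) * A.leadingCoeff) :
    UnprojectedDense {w : Fin 2 ⊕ Fin 2 → ℂ |
      w (Sum.inl 1) = (Polynomial.C (-(I * (x : ℂ) / (2 * Real.pi))) *
        (Polynomial.X - Polynomial.C τ) ^ 2 + Polynomial.C κ).eval (w (Sum.inl 0)) ∧
      MvPolynomial.eval ![w (Sum.inl 0), w (Sum.inr 0)] P = 0} := by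
  by_cases hres : ¬ Irrational x ∧ ¬ Irrational (x * φ / Real.pi)
  · -- resonance: `x = q ∈ ℚ`, `φ = π r` with `r = r'/q ∈ ℚ`
    obtain ⟨hx', hr'⟩ := hres
    obtain ⟨q, hq⟩ : ∃ q : ℚ, (q : ℝ) = x := by simpa [Irrational] using hx'
    obtain ⟨r', hr'⟩ : ∃ r' : ℚ, (r' : ℝ) = x * φ / Real.pi := by simpa [Irrational] using hr'
    have hq0 : q ≠ 0 := by rintro rfl; exact hx (by simpa using hq.symm)
    have hφ : φ = Real.pi * ((r' / q : ℚ) : ℝ) := by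
      push_cast
      rw [hr', hq]
      field_simp
    have hlc' : B.leadingCoeff = -Complex.exp (τ + I * Real.pi * ((r' / q : ℚ) : ℂ)) * A.leadingCoeff := by
      rw [hlc, hφ]
      congr 3
      push_cast
      ring
    have hxq : (x : ℂ) = ((q : ℚ) : ℂ) := by rw [← hq]; push_cast; rfl
    rw [hxq]
    exact unprojectedDense_ratResonantGraphSurface A B hP hirr h1 hN hdeg hcop q (r' / q) hq0 τ κ hlc'
  · have hnr : Irrational x ∨ Irrational (x * φ / Real.pi) := by
      by_contra h
      push Not at h
      exact hres h
    exact unprojectedDense_nonresonantGraphSurface A B hP hirr hN hdeg hcop hx φ hnr τ κ hlc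

/-- **Case ∧ dense for every equimodular parabola with a `y₀`-linear fibre.**
[cite: MantovaMasser2023, §1 Further remarks, p. 5 (the question, open in general)] (new) -/
theorem unprojectedDensityQuestion_equimodularParabola
    (hP : ∀ x y : ℂ, MvPolynomial.eval ![x, y] P = A.eval x * y + B.eval x) (hirr : Irreducible P)
    (h1 : ∃ v ∈ P.support, ∃ v' ∈ P.support, v 1 ≠ v' 1) (hN : 1 ≤ A.natDegree)
    (hdeg : B.natDegree = A.natDegree) (hcop : IsCoprime A B) {x : ℝ} (hx : x ≠ 0) (φ : ℝ) (τ κ : ℂ)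
    (hlc : B.leadingCoeff = -Complex.exp (τ + φ * I) * A.leadingCoeff) :
    MMCaseDimPiOneFree {w : Fin 2 ⊕ Fin 2 → ℂ |
      w (Sum.inl 1) = (Polynomial.C (-(I * (x : ℂ) / (2 * Real.pi))) *
        (Polynomial.X - Polynomial.C τ) ^ 2 + Polynomial.C κ).eval (w (Sum.inl 0)) ∧
      MvPolynomial.eval ![w (Sum.inl 0), w (Sum.inr 0)] P = 0} ∧
    UnprojectedDense {w : Fin 2 ⊕ Fin 2 → ℂ |
      w (Sum.inl 1) = (Polynomial.C (-(I * (x : ℂ) / (2 * Real.pi))) *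
        (Polynomial.X - Polynomial.C τ) ^ 2 + Polynomial.C κ).eval (w (Sum.inl 0)) ∧
      MvPolynomial.eval ![w (Sum.inl 0), w (Sum.inr 0)] P = 0} := by
  refine ⟨mmCase_fibreCurveSurface _ ?_ hirr ?_,
    unprojectedDense_equimodularParabola A B hP hirr h1 hN hdeg hcop hx φ τ κ hlc⟩
  · have hπ : (Real.pi : ℂ) ≠ 0 := by exact_mod_cast Real.pi_ne_zero
    have hc : (-(I * (x : ℂ) / (2 * Real.pi)) : ℂ) ≠ 0 := by
      rw [neg_ne_zero, div_ne_zero_iff]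
      exact ⟨mul_ne_zero Complex.I_ne_zero (by exact_mod_cast hx), mul_ne_zero two_ne_zero hπ⟩
    rw [Polynomial.natDegree_add_C, Polynomial.natDegree_C_mul hc, Polynomial.natDegree_pow,
      Polynomial.natDegree_X_sub_C]
  · have hA0 : A ≠ 0 := by
      intro h; rw [h, Polynomial.natDegree_zero] at hN; omega
    have hB0 : B ≠ 0 := by
      intro h
      rw [h, Polynomial.leadingCoeff_zero] at hlc
      exact mul_ne_zero (neg_ne_zero.2 (Complex.exp_ne_zero _)) (Polynomial.leadingCoeff_ne_zero.2 hA0)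
        hlc.symm
    refine ((Polynomial.finite_setOf_isRoot (mul_ne_zero hA0 hB0)).infinite_compl).mono ?_
    intro t ht
    simp only [Set.mem_compl_iff, Set.mem_setOf_eq, Polynomial.IsRoot, Polynomial.eval_mul,
      mul_eq_zero, not_or] at ht
    have hA : A.eval t ≠ 0 := ht.1
    refine ⟨-B.eval t / A.eval t, div_ne_zero (neg_ne_zero.2 ht.2) hA, ?_⟩
    rw [hP, mul_div_cancel₀ _ hA, neg_add_cancel]

end Main

/-! ## Part B. Example with irrational curvature: `{x₁ = -(i√2/2π) x₀², x₀ y₀ = x₀ + 1}` -/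

/-- **`{x₁ = -(i√2/(2π)) x₀², x₀ y₀ = x₀ + 1}` is in the case and DENSE** (non-resonant: the
curvature coefficient `√2` is irrational; the phases `e^{2πi√2 k²}` are equidistributed-like, yet the
exponential points are Zariski dense).
[cite: MantovaMasser2023, §1 Further remarks, p. 5 (the question, open in general)] (new) -/
theorem unprojectedDensityQuestion_instance_sqrtTwoParabola_ratFibre :
    MMCaseDimPiOneFree {w : Fin 2 ⊕ Fin 2 → ℂ |
      w (Sum.inl 1) = -(I * Real.sqrt 2 / (2 * Real.pi)) * w (Sum.inl 0) ^ 2 ∧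
        w (Sum.inl 0) * w (Sum.inr 0) - w (Sum.inl 0) - 1 = 0} ∧
    UnprojectedDense {w : Fin 2 ⊕ Fin 2 → ℂ |
      w (Sum.inl 1) = -(I * Real.sqrt 2 / (2 * Real.pi)) * w (Sum.inl 0) ^ 2 ∧
        w (Sum.inl 0) * w (Sum.inr 0) - w (Sum.inl 0) - 1 = 0} := by
  have hset : {w : Fin 2 ⊕ Fin 2 → ℂ |
      w (Sum.inl 1) = -(I * Real.sqrt 2 / (2 * Real.pi)) * w (Sum.inl 0) ^ 2 ∧
        w (Sum.inl 0) * w (Sum.inr 0) - w (Sum.inl 0) - 1 = 0} =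
      {w : Fin 2 ⊕ Fin 2 → ℂ |
        w (Sum.inl 1) = (Polynomial.C (-(I * ((Real.sqrt 2 : ℝ) : ℂ) / (2 * Real.pi))) *
          (Polynomial.X - Polynomial.C 0) ^ 2 + Polynomial.C 0).eval (w (Sum.inl 0)) ∧
        MvPolynomial.eval ![w (Sum.inl 0), w (Sum.inr 0)]
          (X 0 * X 1 - X 0 - 1 : MvPolynomial (Fin 2) ℂ) = 0} := by
    ext w
    simp only [Set.mem_setOf_eq, map_zero, sub_zero, add_zero, Polynomial.eval_mul, Polynomial.eval_C,
      Polynomial.eval_pow, Polynomial.eval_X, MvPolynomial.eval_X, map_sub, map_mul, map_one,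
      Matrix.cons_val_zero, Matrix.cons_val_one]
  rw [hset]
  refine unprojectedDensityQuestion_equimodularParabola Polynomial.X (-Polynomial.X - 1)
    eval_resonantP irreducible_resonantP resonantP_support_pair (by simp) ?_ ?_
    (Real.sqrt_ne_zero'.2 two_pos) 0 0 0 ?_
  · rw [Polynomial.natDegree_X, show (-Polynomial.X - 1 : Polynomial ℂ) = -(Polynomial.X + Polynomial.C 1)
      by rw [map_one]; ring, Polynomial.natDegree_neg, Polynomial.natDegree_X_add_C]
  · exact ⟨-1, -1, by ring⟩
  · rw [show (-Polynomial.X - 1 : Polynomial ℂ) = -(Polynomial.X + Polynomial.C 1) by rw [map_one]; ring,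
      Polynomial.leadingCoeff_neg, Polynomial.leadingCoeff_X_add_C, Polynomial.leadingCoeff_X]
    simp

end Summit.Schanuel.Schanuel.Theorems
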